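import Literature.NumberTheory.Weil1964.AdelicThetaDistribution
import Literature.NumberTheory.Automorphic.AdeleRingTopology
import Mathlib.Analysis.Calculus.BumpFunction.FiniteDimension
import HarnessLib

/-!
# A non-degeneracy witness for the adelic theta distribution

KERNEL file (no cited facts used as hypotheses; no `def … : Prop` records).  For the Schwartz–Bruhat
model of Weil's theta datum (`Weil1964.AdelicThetaDistribution`: carrier `piSchwartzBruhat F ι`, theta
distribution `Θ(Φ) = Σ_{ξ ∈ F^ι} Φ(ξ)`), we exhibit an explicit test function

`Φ₀(x) = β(x_∞) · 𝟙[x_f ∈ ∏_{i, v} 𝒪_v]`,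

`β` a smooth bump function at `0` on `(F ⊗ ℝ)^ι` (Mathlib `ContDiffBump`, values in `[0, 1]`, `β(0) = 1`)
and `𝟙` the indicator of the integral finite vectors (compact open), and prove

* `thetaWitness_mem` — `Φ₀ ∈ piSchwartzBruhat F ι` (a pure tensor of a Schwartz function and a
  Schwartz–Bruhat function);
* `thetaWitness_zero` — `Φ₀(0) = 1`, all values real and in `[0, 1]`;
* `one_le_re_thetaDist_thetaWitness`, **`thetaDist_thetaWitness_ne_zero`** — `Re Θ(Φ₀) ≥ 1`, hence
  `Θ(Φ₀) ≠ 0`: the theta distribution of the model is not the zero functional and the carrier is not the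
  zero space (`piSchwartzBruhat_ne_bot`).

This is the "no degenerate in-scope data" check for the theta-kernel datum built on this carrier, and the
input `Θ ≠ 0` of the scalar-detection step in the splitting of the metaplectic cocycle over rational points
(`Literature.GroupTheory.InvariantFunctionalSplitting`, `detectsScalars_of_linear`).  The finite factor
`finWitness` is the special case `x₀ = 0`, `𝔫 = 1` of the level-coset indicators `𝟙[x₀ + (𝔫𝒪̂)^ι]`
(test vectors of the see-saw supply argument); it is kept self-contained here.

## References
* A. Weil, *Sur certains groupes d'opérateurs unitaires*, Acta Math. 111 (1964), Chap. III n° 41,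
  p. 193 (`Θ(Φ) = Σ_{ξ ∈ X_k} Φ(ξ)`) [Weil1964].
-/

set_option autoImplicit false

noncomputable section

open scoped BigOperators Topology Classical RestrictedProduct
open NumberField NumberField.mixedEmbedding IsDedekindDomain Set

namespace Literature.NumberTheory.Weil1964

open Literature.NumberTheory.Automorphic

variable (F : Type) [Field F] [NumberField F] (ι : Type)

/-! ### §1. The finite component: the indicator of the integral vectors -/

/-- The integral finite vectors `∏_{i ∈ ι} ∏_v 𝒪_v ⊆ (𝔸_{F,f})^ι`. [folklore] -/
def intFinVec : Set (ι → FiniteAdeleRing (𝓞 F) F) :=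
  {a | ∀ i v, a i v ∈ v.adicCompletionIntegers F}

/-- The integral vectors as a product set. [folklore] -/
theorem intFinVec_eq_pi : intFinVec F ι =
    Set.univ.pi fun _ : ι => {a : FiniteAdeleRing (𝓞 F) F | ∀ v, a v ∈ v.adicCompletionIntegers F} := by
  ext a
  simp only [intFinVec, mem_setOf_eq, mem_univ_pi]

/-- `0` is an integral vector. [folklore] -/
theorem zero_mem_intFinVec : (0 : ι → FiniteAdeleRing (𝓞 F) F) ∈ intFinVec F ι :=
  fun _ v => (v.adicCompletionIntegers F).zero_mem

/-- The integral vectors form a compact set (`𝒪_v` compact, Tychonoff). [folklore] -/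
theorem isCompact_intFinVec : IsCompact (intFinVec F ι) := by
  haveI : ∀ v : HeightOneSpectrum (𝓞 F), CompactSpace (v.adicCompletionIntegers F) :=
    compactSpace_adicCompletionIntegers' F
  rw [intFinVec_eq_pi]
  exact isCompact_univ_pi fun _ => FiniteAdeleRing.isCompact_setOf_forall_mem (𝓞 F) F

/-- The integral vectors form a closed set (compact in a Hausdorff space). [folklore] -/
theorem isClosed_intFinVec : IsClosed (intFinVec F ι) := by
  haveI : T2Space (FiniteAdeleRing (𝓞 F) F) := inferInstanceAs <| T2Space
    (Πʳ w : HeightOneSpectrum (𝓞 F), [w.adicCompletion F, w.adicCompletionIntegers F])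
  exact (isCompact_intFinVec F ι).isClosed

/-- The finite component of the witness: `𝟙[a ∈ ∏ 𝒪_v]`. [folklore] -/
def finWitness : (ι → FiniteAdeleRing (𝓞 F) F) → ℂ :=
  (intFinVec F ι).indicator fun _ => 1

/-- Unfolding of `finWitness`. [folklore] -/
theorem finWitness_apply (a : ι → FiniteAdeleRing (𝓞 F) F) :
    finWitness F ι a = (intFinVec F ι).indicator (fun _ => (1 : ℂ)) a := rfl

variable [Fintype ι]

/-- The integral vectors form an open set. [folklore] -/
theorem isOpen_intFinVec : IsOpen (intFinVec F ι) := by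
  rw [intFinVec_eq_pi]
  exact isOpen_set_pi finite_univ fun _ _ => FiniteAdeleRing.isOpen_setOf_forall_mem (𝓞 F) F

/-- The indicator of the (clopen, compact) integral vectors is a Schwartz–Bruhat function. [folklore] -/
theorem finWitness_mem : finWitness F ι ∈ SchwartzBruhat (ι → FiniteAdeleRing (𝓞 F) F) := by
  refine ⟨(IsLocallyConstant.iff_exists_open _).2 fun x => ?_,
    HasCompactSupport.intro (isCompact_intFinVec F ι) fun x hx => indicator_of_notMem hx _⟩
  by_cases hx : x ∈ intFinVec F ι
  · exact ⟨intFinVec F ι, isOpen_intFinVec F ι, hx, fun y hy => by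
      rw [finWitness_apply, finWitness_apply, indicator_of_mem hy, indicator_of_mem hx]⟩
  · exact ⟨(intFinVec F ι)ᶜ, (isClosed_intFinVec F ι).isOpen_compl, hx, fun y hy => by
      rw [finWitness_apply, finWitness_apply, indicator_of_notMem (notMem_of_mem_compl hy),
        indicator_of_notMem hx]⟩

/-! ### §2. The archimedean component: a smooth bump at `0` -/

/-- A smooth bump function at `0` on `(F ⊗ ℝ)^ι` (radii `1 < 2`). [folklore] -/
def archBump : ContDiffBump (0 : ι → mixedSpace F) := ⟨1, 2, one_pos, one_lt_two⟩

/-- The bump function as a complex-valued Schwartz function. [folklore] -/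
def archWitness : SchwartzMap (ι → mixedSpace F) ℂ :=
  HasCompactSupport.toSchwartzMap (f := fun x => ((archBump F ι) x : ℂ))
    ((archBump F ι).hasCompactSupport.comp_left Complex.ofReal_zero)
    (Complex.ofRealCLM.contDiff.comp (archBump F ι).contDiff)

/-- Unfolding of `archWitness`. [folklore] -/
theorem archWitness_apply (x : ι → mixedSpace F) : archWitness F ι x = ((archBump F ι) x : ℂ) := rfl

/-- `β(0) = 1`. [folklore] -/
theorem archWitness_zero : archWitness F ι 0 = 1 := by
  rw [archWitness_apply, (archBump F ι).one_of_mem_closedBall (Metric.mem_closedBall_self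
    (archBump F ι).rIn_pos.le), Complex.ofReal_one]

/-! ### §3. The witness and its theta value -/

/-- **The witness** `Φ₀(x) = β(x_∞) · 𝟙[x_f ∈ ∏ 𝒪_v]`. [folklore] -/
def thetaWitness : (ι → AdeleRing (𝓞 F) F) → ℂ :=
  fun v => archWitness F ι (piArch F ι v) * finWitness F ι (piFinite F ι v)

/-- Unfolding of `thetaWitness`. [folklore] -/
theorem thetaWitness_apply (v : ι → AdeleRing (𝓞 F) F) :
    thetaWitness F ι v = archWitness F ι (piArch F ι v) * finWitness F ι (piFinite F ι v) := rfl

/-- `Φ₀` is a Schwartz–Bruhat function on `𝔸_F^ι`. [folklore] -/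
theorem thetaWitness_mem : thetaWitness F ι ∈ piSchwartzBruhat F ι :=
  tensor_mem_piSchwartzBruhat (archWitness F ι) (finWitness_mem F ι)

omit [Fintype ι] in
/-- `piArch 0 = 0`. [folklore] -/
theorem piArch_zero : piArch F ι 0 = 0 :=
  funext fun i => by
    rw [piArch_apply, Pi.zero_apply]
    exact (map_zero (InfiniteAdeleRing.ringEquiv_mixedSpace F))

omit [Fintype ι] in
/-- `piFinite 0 = 0`. [folklore] -/
theorem piFinite_zero : piFinite F ι 0 = 0 := rfl

/-- `Φ₀(0) = 1`. [folklore] -/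
theorem thetaWitness_zero : thetaWitness F ι 0 = 1 := by
  rw [thetaWitness_apply, piArch_zero, piFinite_zero, archWitness_zero, finWitness_apply,
    indicator_of_mem (zero_mem_intFinVec F ι), mul_one]

/-- The values of `Φ₀` are real numbers in `[0, 1]`: `Φ₀(v) = r` with `0 ≤ r`. [folklore] -/
theorem thetaWitness_re_nonneg (v : ι → AdeleRing (𝓞 F) F) : 0 ≤ (thetaWitness F ι v).re := by
  rw [thetaWitness_apply, archWitness_apply, finWitness_apply]
  by_cases h : piFinite F ι v ∈ intFinVec F ι
  · rw [indicator_of_mem h, mul_one, Complex.ofReal_re]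
    exact (archBump F ι).nonneg
  · rw [indicator_of_notMem h, mul_zero, Complex.zero_re]

/-- **`Re Θ(Φ₀) ≥ 1`**: all terms of `Θ(Φ₀) = Σ_ξ Φ₀(ξ)` are `≥ 0` and the term `ξ = 0` is `1`.
[cite: Weil1964, Chap. III n° 41, p. 193] -/
theorem one_le_re_thetaDist_thetaWitness : 1 ≤ (thetaDist F ι (thetaWitness F ι)).re := by
  have hs : Summable fun ξ : ι → F => thetaWitness F ι (ratPt F ι ξ) :=
    summable_ratPt (thetaWitness_mem F ι)
  have hre : (thetaDist F ι (thetaWitness F ι)).re =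
      ∑' ξ : ι → F, (thetaWitness F ι (ratPt F ι ξ)).re := by
    rw [thetaDist]
    exact Complex.re_tsum hs
  rw [hre]
  have h0 : (thetaWitness F ι (ratPt F ι 0)).re = 1 := by
    rw [ratPt_zero, thetaWitness_zero, Complex.one_re]
  rw [← h0]
  exact (Complex.reCLM.summable hs).le_tsum 0 fun ξ _ => thetaWitness_re_nonneg F ι _

/-- **The theta distribution does not vanish on `Φ₀`**: `Θ(Φ₀) ≠ 0`. [cite: Weil1964, Chap. III n° 41, p. 193] -/
theorem thetaDist_thetaWitness_ne_zero : thetaDist F ι (thetaWitness F ι) ≠ 0 := by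
  intro h
  have h1 := one_le_re_thetaDist_thetaWitness F ι
  rw [h, Complex.zero_re] at h1
  exact absurd h1 (by norm_num)

/-- The same for the linear theta distribution on the submodule. [folklore] -/
theorem thetaDistLM_thetaWitness_ne_zero :
    thetaDistLM F ι ⟨thetaWitness F ι, thetaWitness_mem F ι⟩ ≠ 0 :=
  thetaDist_thetaWitness_ne_zero F ι

/-- The theta distribution is not the zero functional. [folklore] -/
theorem thetaDistLM_ne_zero : thetaDistLM F ι ≠ 0 := by
  intro h
  exact thetaDistLM_thetaWitness_ne_zero F ι (by rw [h, LinearMap.zero_apply])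

/-- The Schwartz–Bruhat space `𝒮(𝔸_F^ι)` is not the zero space. [folklore] -/
theorem piSchwartzBruhat_ne_bot : piSchwartzBruhat F ι ≠ ⊥ := by
  intro h
  have hmem : thetaWitness F ι ∈ (⊥ : Submodule ℂ ((ι → AdeleRing (𝓞 F) F) → ℂ)) := h ▸ thetaWitness_mem F ι
  rw [Submodule.mem_bot] at hmem
  have h1 := thetaWitness_zero F ι
  rw [hmem, Pi.zero_apply] at h1
  exact zero_ne_one h1

end Literature.NumberTheory.Weil1964

end
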